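import Mathlib
import Literature.MathematicalPhysics.QuantumFieldTheory.Balaban1983to89.B14Eq357KernelDecay
import Literature.MathematicalPhysics.QuantumFieldTheory.Balaban1983to89.B14Eq362Marginals

/-!
# `Balaban1983to89.B14.Eq362KernelWard` — T. Bałaban, *Convergent renormalization expansions for lattice gauge theories*,
# Commun. Math. Phys. **119** (1988) 243–285 [Balaban1988Convergent]: the step *"Using … the identity (I.4.15) again"* of
# (3.62) p. 282 for the WHOLE-LATTICE kernel `Π^{(j)}_{μν}(x, y, z)` of p. 281 — the Ward–Takahashi identity (I.4.15)₁ of the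
# series `Σ_{X∋z}` DERIVED from the gauge invariance (2.27)(iii) of its localized terms; with `B14.Eq357KernelDecay` this leaves
# the (3.61)–(3.64) chain `β′_j = β_j` with exactly the printed inputs

statement-level skeleton of published theorems with citation tags; proofs where landed; nothing here is a claim about the Yang–Mills mass gap

PDF held: `paper:balaban1988-cmp119-convergent-renormalization` (journal page = PDF page + 242); pp. 259, 280–283 [PDF 17, 38–41]
re-read as images on the x2 renders of the cell `pub-balaban`.

CITATION HEADER (lean-in-tree rule).  WHAT IS REPRODUCED, verbatim.  [Balaban1988Convergent] (2.27) p. 259: *"𝐄^{(j)}(Λ_j, U_k,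
z) = Σ_{X∋z} 𝐄^{(j)}(X, U_k, z), (2.27) where the last sum is over localization domains X ∈ 𝐃_j contained in Λ_j, X ⊂ Λ_j. The
term 𝐄^{(j)}(X, U_k, z) of the last sum has the following properties: (i) it depends on U_k restricted to X; (ii) there exists an
analytic function 𝐄^{(j)}(X, (𝐔, 𝐉), z) of the variables (𝐔, 𝐉) ∈ U_j^c(X, α_{0,j}, α_{1,j}), which is an extension of this term,
i.e., the equality (I.1.9) is satisfied; (iii) the extended function is invariant with respect to the gauge transformations
(I.1.10); (iv) it satisfies the inequality (I.1.18)."* (v1.1: quotation completed to the verbatim text of p. 259; v1 abridged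
it); p. 281: *"the function
Π^{(j)}_{μν}(x, y, z) is given by the formula (3.50), but with 𝐄^{(j)}(X, U_j, z) replaced by 𝐄^{(j)}(U_j, z) defined on the
whole lattice L⁻ʲZ^d"*; p. 282: *"Using the translation invariance and the identity (I.4.15) again we have β′_j = Σ_{x,y}
Π^{(j)}_{22}(x, y, 0)x₁y₁ = −½Σ_{x,y}Π^{(j)}_{22}(x, y, 0)(x₁ − y₁)² = … (3.62)"*.  [Balaban1987RG1] p. 284, (4.15), first
identity: *"⟨(δ²/δB²)𝐄(1), B₁, ∂λ⟩ = 0 … for an arbitrary gauge function λ, and arbitrary gauge fields B₁, B₂, B₃"*; p. 283,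
(4.9): *"It is the fundamental identity expressing the gauge invariance of the function 𝐄"*.

SKELETON rows (owner r11): **B14.Eq3.62–3.64** (and B14.Eq3.55–3.57, B14.Eq3.58–3.61).  State of the chain: `B14.Eq362Marginals.
eq364_of_WT` takes the whole-lattice Ward identity (I.4.15)₁ of `Π^{(j)}_{μν}(x, y, 0)` in both slots as HYPOTHESES `hWT`,
`hWT'` (gauge functions of finite support) and the decay `Decay3`; `B14.Eq357KernelDecay.decay3_threeKernel` derives `Decay3`
for the kernel `threeKernel M K` of a localization expansion.  THIS FILE derives `hWT`, `hWT'` for `threeKernel M K` from the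
SAME identity for each localized term `K X = 𝐄^{(2)}_{μν}(X, ·, ·, z)` — the kernel form of (2.27)(iii) + (I.4.15)₁ per domain
(in the tree: `B14.Lem280Ward.wardY_kernel350`/`wardX_kernel350` produce exactly this kernel form from [I]'s abstract gauge
invariance `B12Ward414`):
* §1 `tsum_ward_of_termwise` — summing termwise Ward identities over a summable series of kernels, for a gauge function of
  FINITE support (the `y`-sum is then finite, `exists_finset_grad_eq_zero`, and finite sums commute with the series);
* §2 **`wardY_threeKernel`**, **`wardX_threeKernel`** — (I.4.15)₁ in the `y`- and in the `x`-slot for `threeKernel M K` at every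
  localization point `z`, from the per-domain identities `hwardY`/`hwardX`, locality (2.27)(i) `hloc` and the kernel bound
  (I.1.18) `hbd` (summability, `B14.Eq357KernelDecay.summable_threeKernel_terms`);
* §3 **`eq364_threeKernel_of_ward`** — `β′_j = β_j` ((3.61)–(3.64)) for the whole-lattice kernel of a localization expansion,
  `B14.Eq362Marginals.eq364_of_WT` with `hD`, `hWT`, `hWT'` ALL DISCHARGED: the remaining inputs are the printed ones —
  translation invariance (p. 281), per-domain gauge invariance in kernel Ward form ((2.27)(iii)/(I.4.15)₁), locality
  (2.27)(i), the bound (I.1.18), and [I]'s Taylor data (I.5.16) of the summed kernel; also `marginals_threeKernel` (both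
  marginal identities of (3.62)).
Model notes: as in `B14.Eq357KernelDecay` (M1″–M4″); gauge functions `λ : L⁻ʲZ^d → ℝ` of finite support (scalar components,
`B14.Eq362Marginals`).  Theorems only; no `sorry`.

Mega-formalization `lit-balaban`, unit `lit-balaban-r11` gen 6 (B14 fold owner), HOME `run/shared/lean/pub/lit-balaban/`.

## References
* [Balaban1988Convergent] T. Bałaban, Commun. Math. Phys. 119 (1988) 243–285, (2.27) p.259, p.281, (3.62) p.282, (3.64) p.283.
* [Balaban1987RG1] T. Bałaban, Commun. Math. Phys. 109 (1987) 249–301 ([I]: (4.9) p.283, (4.15) p.284, (1.18) p.261).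
-/

namespace Literature.MathematicalPhysics.QuantumFieldTheory.Balaban1983to89.B14.Eq362KernelWard

noncomputable section

open Literature.MathematicalPhysics.QuantumFieldTheory.Balaban1983to89
open Literature.MathematicalPhysics.QuantumFieldTheory.Balaban1983to89.B13ScaleTransfer
open Literature.MathematicalPhysics.QuantumFieldTheory.Balaban1983to89.TreeLength
open Literature.MathematicalPhysics.QuantumFieldTheory.Balaban1983to89.B12TreeDecay
open Literature.MathematicalPhysics.QuantumFieldTheory.Balaban1983to89.B14.Eq364Beta
open Literature.MathematicalPhysics.QuantumFieldTheory.Balaban1983to89.B14.Eq357KernelDecay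
open Literature.MathematicalPhysics.QuantumFieldTheory.Balaban1983to89.B14.Eq362Marginals (grad)
open Literature.MathematicalPhysics.QuantumFieldTheory.GawedzkiKupiainen1985.PeriodicGleason (unitVec)
open Finset

variable {d : ℕ}

/-! ## §1. Termwise Ward identities sum -/

/-- For a gauge function of finite support, the lattice gradients `(∂_νλ)(y) = λ(y + e_ν) − λ(y)` vanish outside a finite
set of sites. [cite: Balaban1987RG1, (4.15) p.284] -/
theorem exists_finset_grad_eq_zero (lam : Pt d → ℝ) (hlam : (Function.support lam).Finite) :
    ∃ T : Finset (Pt d), ∀ y ∉ T, ∀ ν : Fin d, grad lam ν y = 0 := by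
  classical
  refine ⟨hlam.toFinset ∪ Finset.univ.biUnion (fun ν => hlam.toFinset.image fun y => y - unitVec ν), ?_⟩
  intro y hy ν
  rw [Finset.mem_union, not_or] at hy
  have h1 : lam y = 0 := by
    by_contra h
    exact hy.1 (hlam.mem_toFinset.2 (Function.mem_support.2 h))
  have h2 : lam (y + unitVec ν) = 0 := by
    by_contra h
    apply hy.2
    refine Finset.mem_biUnion.2 ⟨ν, Finset.mem_univ ν, Finset.mem_image.2 ⟨y + unitVec ν, ?_, by simp⟩⟩
    exact hlam.mem_toFinset.2 (Function.mem_support.2 h)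
  simp [grad, h1, h2]

/-- **Summing termwise Ward identities**: if every kernel `t_i` of a pointwise summable family satisfies
`Σ_y Σ_ν t_i(ν, y)(∂_νλ)(y) = 0` for a gauge function `λ` of finite support, so does the series `Σ_i t_i` (the `y`-sum is
finite; finite sums commute with the series). [cite: Balaban1987RG1, (4.15) p.284] -/
theorem tsum_ward_of_termwise {ι : Type*} (t : ι → Fin d → Pt d → ℝ) (hsum : ∀ ν y, Summable fun i => t i ν y)
    (lam : Pt d → ℝ) (hlam : (Function.support lam).Finite)
    (hward : ∀ i, ∑' y, ∑ ν, t i ν y * grad lam ν y = 0) :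
    ∑' y, ∑ ν, (∑' i, t i ν y) * grad lam ν y = 0 := by
  classical
  obtain ⟨T, hT⟩ := exists_finset_grad_eq_zero lam hlam
  have hsum' : ∀ ν y, Summable fun i => t i ν y * grad lam ν y := fun ν y => (hsum ν y).mul_right _
  -- the y-series is a finite sum
  rw [tsum_eq_sum (s := T) (fun y hy => by simp [hT y hy])]
  -- pull the series out of the finite sums
  have h1 : ∀ y ∈ T, ∑ ν, (∑' i, t i ν y) * grad lam ν y = ∑' i, ∑ ν, t i ν y * grad lam ν y := by
    intro y _
    rw [Summable.tsum_finsetSum (fun ν _ => hsum' ν y)]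
    refine Finset.sum_congr rfl fun ν _ => ?_
    rw [tsum_mul_right]
  rw [Finset.sum_congr rfl h1, ← Summable.tsum_finsetSum (fun y _ => summable_sum fun ν _ => hsum' ν y)]
  -- termwise: the finite sum over T is the full y-series, which vanishes
  have h2 : ∀ i, ∑ y ∈ T, ∑ ν, t i ν y * grad lam ν y = 0 := by
    intro i
    have e : ∑' y, ∑ ν, t i ν y * grad lam ν y = ∑ y ∈ T, ∑ ν, t i ν y * grad lam ν y :=
      tsum_eq_sum (s := T) fun y hy => by simp [hT y hy]
    rw [← e]
    exact hward i
  simp [h2]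

/-! ## §2. (I.4.15)₁ for the whole-lattice kernel from the localized terms -/

variable {M : ℕ} {K : Finset (Pt d) → Fin d → Fin d → Pt d → Pt d → ℝ} {E₂ κ : ℝ}

/-- **(I.4.15)₁ in the `y`-slot for `Π^{(j)}_{μν}(x, y, z)`** (p. 282 *"the identity (I.4.15) again"*, the hypothesis `hWT` of
`B14.Eq362Marginals.marginal_y_eq_zero`): `Σ_y Σ_ν Π_{μν}(x, y, z)(∂_νλ)(y) = 0` for every gauge function `λ` of finite support,
FROM the same identity for every localized kernel `𝐄^{(2)}(X, ·)` ((2.27)(iii) gauge invariance of the terms, kernel form) —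
given locality (2.27)(i) and the bound (I.1.18) that make the series converge (`κ/3 ≥ κ₀(4·2^d, 2d)`).
[cite: Balaban1988Convergent, (3.62) p.282] -/
theorem wardY_threeKernel (hM : 0 < M) (hE₂ : 0 ≤ E₂) (hκ : kappa₀ (4 * 2 ^ d) (2 * d) ≤ κ / 3) (hκ0 : 0 ≤ κ)
    (hloc : ∀ X μ ν x y, K X μ ν x y ≠ 0 → coarse M x ∈ X ∧ coarse M y ∈ X)
    (hbd : ∀ X : LocDom d, ∀ μ ν x y, |K X.1 μ ν x y| ≤ E₂ * Real.exp (-κ * treeLen X.1))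
    (hwardY : ∀ X : LocDom d, ∀ (μ : Fin d) (x : Pt d) (lam : Pt d → ℝ), (Function.support lam).Finite →
      ∑' y, ∑ ν, K X.1 μ ν x y * grad lam ν y = 0)
    (z : Pt d) (μ : Fin d) (x : Pt d) (lam : Pt d → ℝ) (hlam : (Function.support lam).Finite) :
    ∑' y, ∑ ν, threeKernel M K μ ν x y z * grad lam ν y = 0 := by
  have h := tsum_ward_of_termwise (ι := LocDom d)
    (fun X ν y => if coarse M z ∈ X.1 then K X.1 μ ν x y else 0)
    (fun ν y => summable_threeKernel_terms hM hE₂ hκ hκ0 hloc hbd μ ν x y z) lam hlam ?_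
  · simpa [threeKernel] using h
  · intro X
    by_cases hz : coarse M z ∈ X.1
    · simp only [hz, if_true]
      exact hwardY X μ x lam hlam
    · simp [hz]

/-- **(I.4.15)₁ in the `x`-slot for `Π^{(j)}_{μν}(x, y, z)`** (the hypothesis `hWT'` of `B14.Eq362Marginals.marginal_x_eq_zero`):
`Σ_x Σ_μ Π_{μν}(x, y, z)(∂_μλ)(x) = 0`, from the per-domain identities in the `x`-slot.
[cite: Balaban1988Convergent, (3.62) p.282] -/
theorem wardX_threeKernel (hM : 0 < M) (hE₂ : 0 ≤ E₂) (hκ : kappa₀ (4 * 2 ^ d) (2 * d) ≤ κ / 3) (hκ0 : 0 ≤ κ)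
    (hloc : ∀ X μ ν x y, K X μ ν x y ≠ 0 → coarse M x ∈ X ∧ coarse M y ∈ X)
    (hbd : ∀ X : LocDom d, ∀ μ ν x y, |K X.1 μ ν x y| ≤ E₂ * Real.exp (-κ * treeLen X.1))
    (hwardX : ∀ X : LocDom d, ∀ (ν : Fin d) (y : Pt d) (lam : Pt d → ℝ), (Function.support lam).Finite →
      ∑' x, ∑ μ, K X.1 μ ν x y * grad lam μ x = 0)
    (z : Pt d) (ν : Fin d) (y : Pt d) (lam : Pt d → ℝ) (hlam : (Function.support lam).Finite) :
    ∑' x, ∑ μ, threeKernel M K μ ν x y z * grad lam μ x = 0 := by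
  have h := tsum_ward_of_termwise (ι := LocDom d)
    (fun X μ x => if coarse M z ∈ X.1 then K X.1 μ ν x y else 0)
    (fun μ x => summable_threeKernel_terms hM hE₂ hκ hκ0 hloc hbd μ ν x y z) lam hlam ?_
  · simpa [threeKernel] using h
  · intro X
    by_cases hz : coarse M z ∈ X.1
    · simp only [hz, if_true]
      exact hwardX X ν y lam hlam
    · simp [hz]

/-- **Both marginal identities of (3.62)** for the whole-lattice kernel of a localization expansion: `Σ_y Π_{μν}(x, y, 0) = 0 =
Σ_x Π_{μν}(x, y, 0)` — `B14.Eq362Marginals.marginal_y_eq_zero`/`marginal_x_eq_zero` with `Decay3` and (I.4.15)₁ DISCHARGED to the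
per-domain data (`κ > 0`, `d ≥ 1`). [cite: Balaban1988Convergent, (3.62) p.282] -/
theorem marginals_threeKernel (hM : 0 < M) (hd : 0 < d) (hE₂ : 0 ≤ E₂) (hκ : kappa₀ (4 * 2 ^ d) (2 * d) ≤ κ / 3)
    (hκ0 : 0 < κ) (hloc : ∀ X μ ν x y, K X μ ν x y ≠ 0 → coarse M x ∈ X ∧ coarse M y ∈ X)
    (hbd : ∀ X : LocDom d, ∀ μ ν x y, |K X.1 μ ν x y| ≤ E₂ * Real.exp (-κ * treeLen X.1))
    (hwardY : ∀ X : LocDom d, ∀ (μ : Fin d) (x : Pt d) (lam : Pt d → ℝ), (Function.support lam).Finite →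
      ∑' y, ∑ ν, K X.1 μ ν x y * grad lam ν y = 0)
    (hwardX : ∀ X : LocDom d, ∀ (ν : Fin d) (y : Pt d) (lam : Pt d → ℝ), (Function.support lam).Finite →
      ∑' x, ∑ μ, K X.1 μ ν x y * grad lam μ x = 0) (μ ν : Fin d) :
    (∀ x, ∑' y, threeKernel M K μ ν x y 0 = 0) ∧ (∀ y, ∑' x, threeKernel M K μ ν x y 0 = 0) := by
  have hD := decay3_threeKernel hM hE₂ hκ hκ0.le hloc hbd
  have hr : 0 < κ / (3 * d * M) := div_pos hκ0 (by positivity)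
  exact ⟨fun x => Eq362Marginals.marginal_y_eq_zero hD hr
      (fun μ' x' lam hlam => wardY_threeKernel hM hE₂ hκ hκ0.le hloc hbd hwardY 0 μ' x' lam hlam) μ ν x,
    fun y => Eq362Marginals.marginal_x_eq_zero hD hr
      (fun ν' y' lam hlam => wardX_threeKernel hM hE₂ hκ hκ0.le hloc hbd hwardX 0 ν' y' lam hlam) μ ν y⟩

/-! ## §3. (3.61)–(3.64) for the whole-lattice kernel of a localization expansion, inputs as printed -/

/-- **`β′_j = β_j` ((3.61)–(3.64)) WITH `Decay3`, `hWT`, `hWT'` DISCHARGED** — `B14.Eq362Marginals.eq364_of_WT` for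
`threeKernel M K`: for a localization expansion on `L⁻ʲZ^d` with locality (2.27)(i), the kernel bound (I.1.18) (`κ/3 ≥
κ₀(4·2^d, 2d)`), per-domain gauge invariance in kernel Ward form (both slots), whose whole-lattice kernel is translation
invariant (p. 281) and whose summed kernel (3.63) carries [I]'s second-order Taylor data (I.5.16), `β′_j = β`.
[cite: Balaban1988Convergent, (3.64) p.283] -/
theorem eq364_threeKernel_of_ward (hM : 0 < M) (hd : 0 < d) (hE₂ : 0 ≤ E₂)
    (hκ : kappa₀ (4 * 2 ^ d) (2 * d) ≤ κ / 3) (hκ0 : 0 < κ)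
    (hloc : ∀ X μ ν x y, K X μ ν x y ≠ 0 → coarse M x ∈ X ∧ coarse M y ∈ X)
    (hbd : ∀ X : LocDom d, ∀ μ ν x y, |K X.1 μ ν x y| ≤ E₂ * Real.exp (-κ * treeLen X.1))
    (hwardY : ∀ X : LocDom d, ∀ (μ : Fin d) (x : Pt d) (lam : Pt d → ℝ), (Function.support lam).Finite →
      ∑' y, ∑ ν, K X.1 μ ν x y * grad lam ν y = 0)
    (hwardX : ∀ X : LocDom d, ∀ (ν : Fin d) (y : Pt d) (lam : Pt d → ℝ), (Function.support lam).Finite →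
      ∑' x, ∑ μ, K X.1 μ ν x y * grad lam μ x = 0)
    (hT : TranslInv (threeKernel M K)) {one two : Fin d} (h12 : two ≠ one) {β : ℝ}
    (hTD : ∀ μ ν, B12Rep537.TaylorData3 (β : ℂ) μ ν
      (B12Form543.ofRealK (Eq363SummedKernel.sumKernel (threeKernel M K)) μ ν)) :
    betaPrime (threeKernel M K) one two = β :=
  Eq362Marginals.eq364_of_WT hT (decay3_threeKernel hM hE₂ hκ hκ0.le hloc hbd) (div_pos hκ0 (by positivity)) h12
    (fun μ x lam hlam => wardY_threeKernel hM hE₂ hκ hκ0.le hloc hbd hwardY 0 μ x lam hlam)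
    (fun ν y lam hlam => wardX_threeKernel hM hE₂ hκ hκ0.le hloc hbd hwardX 0 ν y lam hlam) hTD

end

end Literature.MathematicalPhysics.QuantumFieldTheory.Balaban1983to89.B14.Eq362KernelWard
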